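import Mathlib

/-!
# Route BarrierLever — item `PartitionMinorsHitByVP` (stmt-ValiantsHypothesis-19717), line `hidden-states`:
# THE DUAL CERTIFICATE ENGINE — a minor of an invertible matrix is nonsingular as soon as the small «inverse-rows × missing-columns» matrix is

Helper file (`--supports stmt-ValiantsHypothesis-19717`; cell valiant-natproofs, rung V4, 𝒟-side door (c); prover seat val-np-p6 gen 10).
Definition-free, Mathlib-only; closes NO item. This is the abstract form of the argument used in `CoStar.det_coStarTop_ne_zero` (p614189) and
`CoStar.det_coStar_ne_zero_of_indep` (p615482), isolated so that further co-star certificates (memo HOME/val-np-p6/g10 §10: block tables, the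
saturated checks) only have to supply three finite objects: the full design matrix `E` on ALL `2^h` rows/columns for an explicit table, rows of a
left inverse at the MISSING columns, and the nonsingularity of one `(c+1) × (c+1)` matrix.

`det_submatrix_ne_zero_of_dual`: let `E : Matrix ι ι R` (`R` a field) have trivial kernel (`E *ᵥ β = 0 → β = 0`), let `u, c : Fin r → ι` (kept rows / kept columns, `c` injective),
`s : Fin n → ι` enumerate injectively the rows NOT kept (every index is a `u i` or an `s l`), and suppose given, for each
non-kept column index `nm l'` (`l' : Fin n`), a DUAL ROW `v l' : ι → R` with `Σ_S v l' S · E S J = [J = nm l']` for all `J`, where the `nm l'` are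
indices outside the range of `c`. If the `n × n` matrix `G l' l := v l' (s l)` has nonzero determinant, then
`det (E.submatrix u c) ≠ 0`. (Jacobi's complementary-minor identity in the form needed here, without adjugates.)

WHAT THIS IS NOT: pure linear algebra; nothing on crux 14610 or VP ≠ VNP.
-/

set_option linter.dupNamespace false

namespace Summit.ValiantsHypothesis.ValiantsHypothesis.Theorems.BarrierLever.HiddenStates

open Finset Matrix

namespace CoStar

/-- **Dual certificate engine.** See the module docstring. -/
theorem det_submatrix_ne_zero_of_dual {ι R : Type*} [Fintype ι] [DecidableEq ι] [Field R] {r n : ℕ}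
    (E : Matrix ι ι R) (hker : ∀ β : ι → R, E.mulVec β = 0 → β = 0)
    (u : Fin r → ι) (c : Fin r → ι) (hc : Function.Injective c)
    (s : Fin n → ι) (hs : Function.Injective s) (hus : ∀ S, (∀ i, u i ≠ S) → ∃ l, s l = S)
    (nm : Fin n → ι) (hcn : ∀ k l', c k ≠ nm l')
    (v : Fin n → ι → R) (hv : ∀ l' J, ∑ S, v l' S * E S J = if J = nm l' then 1 else 0)
    (hG : (Matrix.of fun l' l : Fin n => v l' (s l)).det ≠ 0) :
    (E.submatrix u c).det ≠ 0 := by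
  classical
  intro hdet
  obtain ⟨α, hαne, hα⟩ := Matrix.exists_mulVec_eq_zero_iff.mpr hdet
  -- extend the kernel vector by zero to all columns
  let β : ι → R := fun J => ∑ k : Fin r, if c k = J then α k else 0
  have hβc : ∀ k, β (c k) = α k := by
    intro k
    simp only [β]
    rw [Finset.sum_eq_single k]
    · simp
    · intro k' _ hk'
      rw [if_neg]
      exact fun hh => hk' (hc hh)
    · intro hk; exact absurd (Finset.mem_univ k) hk
  have hβ0 : ∀ J, (∀ k, c k ≠ J) → β J = 0 := by
    intro J hJ
    simp only [β]
    exact Finset.sum_eq_zero fun k _ => if_neg (hJ k)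
  -- γ = E β vanishes on the kept rows
  set γ : ι → R := E.mulVec β with hγ
  have hγu : ∀ i, γ (u i) = 0 := by
    intro i
    have hi := congrFun hα i
    simp only [Matrix.mulVec, dotProduct, Matrix.submatrix_apply, Pi.zero_apply] at hi
    rw [hγ]
    simp only [Matrix.mulVec, dotProduct, β]
    rw [show (∑ J, E (u i) J * ∑ k : Fin r, (if c k = J then α k else 0))
        = ∑ J, ∑ k : Fin r, (if c k = J then E (u i) (c k) * α k else 0) from ?_]
    · rw [Finset.sum_comm]
      rw [show (∑ k : Fin r, ∑ J, (if c k = J then E (u i) (c k) * α k else 0)) = ∑ k : Fin r, E (u i) (c k) * α k from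
        Finset.sum_congr rfl fun k _ => by rw [Finset.sum_ite_eq Finset.univ (c k), if_pos (Finset.mem_univ _)]]
      exact hi
    refine Finset.sum_congr rfl fun J _ => ?_
    rw [Finset.mul_sum]
    refine Finset.sum_congr rfl fun k _ => ?_
    by_cases hk : c k = J
    · rw [if_pos hk, if_pos hk, hk]
    · rw [if_neg hk, if_neg hk, mul_zero]
  have hγS : ∀ S, (∀ l, s l ≠ S) → γ S = 0 := by
    intro S hS
    by_cases hrow : ∃ i, u i = S
    · obtain ⟨i, rfl⟩ := hrow; exact hγu i
    · push Not at hrow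
      obtain ⟨l, hl⟩ := hus S hrow
      exact absurd hl (hS l)
  -- the dual rows read off β at the missing columns: β (nm l') = Σ_S v l' S γ S
  have hread : ∀ l', ∑ S, v l' S * γ S = β (nm l') := by
    intro l'
    have hswap : ∑ S, v l' S * γ S = ∑ J, (∑ S, v l' S * E S J) * β J := by
      rw [hγ]
      simp only [Matrix.mulVec, dotProduct]
      rw [show (∑ S, v l' S * ∑ J, E S J * β J) = ∑ S, ∑ J, v l' S * E S J * β J from
        Finset.sum_congr rfl fun S _ => by rw [Finset.mul_sum]; exact Finset.sum_congr rfl fun J _ => by ring]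
      rw [Finset.sum_comm]
      exact Finset.sum_congr rfl fun J _ => by rw [Finset.sum_mul]
    rw [hswap, Finset.sum_congr rfl fun J _ => by rw [hv l' J, boole_mul], Finset.sum_ite_eq' Finset.univ (nm l'),
      if_pos (Finset.mem_univ _)]
  -- γ is supported on the range of s
  have hsupp : ∀ l', ∑ S, v l' S * γ S = ∑ l, v l' (s l) * γ (s l) := by
    intro l'
    rw [← Finset.sum_subset (Finset.subset_univ (Finset.univ.image s))]
    · rw [Finset.sum_image (fun l _ l₂ _ hll => hs hll)]
    · intro S _ hS
      rw [hγS S (fun l hl => hS (Finset.mem_image.mpr ⟨l, Finset.mem_univ _, hl⟩)), mul_zero]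
  let ε : Fin n → R := fun l => γ (s l)
  -- the system G ε = (β at missing columns) = 0
  have hGε : (Matrix.of fun l' l : Fin n => v l' (s l)).mulVec ε = 0 := by
    funext l'
    rw [Matrix.mulVec, dotProduct, Pi.zero_apply]
    simp only [Matrix.of_apply]
    show ∑ l, v l' (s l) * γ (s l) = 0
    rw [← hsupp, hread]
    exact hβ0 (nm l') (fun k => hcn k l')
  have hε : ε = 0 := Matrix.eq_zero_of_mulVec_eq_zero hG hGε
  -- hence γ vanishes on the image of s, hence everywhere; so β = 0 and α = 0
  have hγs : ∀ l, γ (s l) = 0 := fun l => congrFun hε l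
  have hγ0 : γ = 0 := by
    funext S
    by_cases hS : ∃ l, s l = S
    · obtain ⟨l, rfl⟩ := hS; exact hγs l
    · push Not at hS; exact hγS S hS
  have hβ : β = 0 := hker β (by rw [← hγ]; exact hγ0)
  apply hαne
  funext k
  rw [Pi.zero_apply, ← hβc k, hβ, Pi.zero_apply]

end CoStar

end Summit.ValiantsHypothesis.ValiantsHypothesis.Theorems.BarrierLever.HiddenStates
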